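import Mathlib
import HarnessLib
import Summits.NavierStokesRegularity.NavierStokesRegularity.Theorems.LrcModEntire.Negative.ThickColumnWindow

/-!
# Item `LrcModEntire` (stmt-NavierStokesRegularity-20428) — negative lemma: `stub_twistingThick` of skeleton
# twist-split v4 (sha16 339b80062e2b10b6) is FALSE WITHOUT the Oseen-mild hypothesis (M)

Negative-side lemma (refuter seat ns-regularity-refuter1, KILLSHEET K-50; D-0081 §C; the refuter prompt's «negative
lemma» lane: the conclusion does NOT assert a Theses decl positively).  The registered proof skeleton twist-split v4 of
`LrcModEntire` (`…/Cruxes/LrcModEntire/Lines/twist_split.lean`) has closed `stub_twistingTH` inside the class and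
isolates the research residue in `stub_twistingThick`: Type-I rate (R) + continuity (C) + Oseen-mild (M) +
divergence-free (D) + poloidal (P), and on a non-empty open `W` non-degeneracy, the time-only slope pin, twisting, and
the THICK clause «the shear slope is a function of `(t, x₂)` on NO non-empty open `W₁ ⊆ W`» ⇒ the germ trichotomy.

THIS FILE: the statement of `stub_twistingThick` with hypothesis (M) deleted — everything else VERBATIM — is false
(`twistingThick_false_without_mild`), and stays false with (M) replaced by real-analyticity (A) of every slice
(`twistingThick_false_without_mild_analytic`).  Witness: the thick column `…Negative.thickProfile`,
`v(t, x) = (−t)^{-1/2}(sin x₂ sin x₀, 2 sin 2x₂ sin x₁, cos x₂ cos x₀ + cos 2x₂ cos x₁)`, on `…Negative.thickWindow`: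
its two vertical modes have the incompatible slopes `−1` and `−4`, so NO slope `m` of any kind exists at any point of
the window (both slope clauses hold trivially), the twist bracket is `(−t)^{-1} sin x₀ sin x₁ sin x₂ (2cos² x₂ + 1) ≠ 0`,
and no slice has a germ of any of the three kinds (`thickProfile_no_germ`).  Consequence for provers: any proof of
`stub_twistingThick` must use (M); unlike the (TH) witness (`…Negative.TwistingTHFalseWithoutMild`, frozen), this witness
is NOT frozen (`…Negative.frozen_defect_thickProfile`), so here (M) may already be needed only through the frozen
vorticity law — whether «(R)(C)(D)(P) + frozen + analytic + THICK + twisting» is inhabited is open (refuter1 K-48/K-49: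
no closed form; a numerical bounded solution of the reduced equation exists, job j291279).
WHAT THIS IS NOT: not a claim about Navier–Stokes regularity and not a refutation of the item `LrcModEntire` (whose
class includes (M)) — a kernel-checked record of which hypothesis of the residual stub is load-bearing. [folklore]
-/

noncomputable section

-- the summit and its single sub-problem share the name (CONVENTIONS §1), as in every Theorems file
set_option linter.dupNamespace false

namespace Summit.NavierStokesRegularity.NavierStokesRegularity.Theorems.LrcModEntire.Negative

open MeasureTheory Set Function Filter Topology Metric
open scoped RealInnerProductSpace InnerProductSpace
open Literature.Analysis Literature.Analysis.FluidPDE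
open Summit.NavierStokesRegularity.NavierStokesRegularity.Theorems.PoloidalWindowRigidity.Negative

local notation "E3" => EuclideanSpace ℝ (Fin 3)
local notation "𝐞" i => (EuclideanSpace.single (i : Fin 3) (1 : ℝ) : EuclideanSpace ℝ (Fin 3))

/-- The germ trichotomy fails for every slice of the thick column on every window. [folklore] -/
theorem thickProfile_no_germ {s : ℝ} (hs : s < 0) {U : Set E3} (hU : IsOpen U) (hne : U.Nonempty) :
    ¬ ((∃ e : E3, e ≠ 0 ∧ ∀ y ∈ U, fderiv ℝ (curl (thickProfile s)) y e = 0) ∨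
       (∃ c : E3, ∀ y ∈ U, rotGen (curl (thickProfile s) y) = fderiv ℝ (curl (thickProfile s)) y (rotGen (y - c))) ∨
       (∃ w : E3 → E3, AnalyticOnNhd ℝ w Set.univ ∧ ¬ BddAbove (Set.range fun y => ‖w y‖) ∧
          ∀ y ∈ U, thickProfile s y = w y)) := by
  rintro (⟨e, he, htr⟩ | ⟨c, hrot⟩ | ⟨w, hw, hunb, hwU⟩)
  · exact thickProfile_no_translation_germ hs hU hne he htr
  · exact thickProfile_no_rotation_germ hs hU hne c hrot
  · exact hunb (thickProfile_no_unbounded_entire_germ s hU hne hw hwU)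

/-- **`stub_twistingThick` of skeleton twist-split v4 is FALSE without the Oseen-mild identity (M).**  The hypotheses are
those of `stub_twistingThick` VERBATIM with (M) deleted; the thick column (`C = 10`, window `thickWindow`) satisfies all
of them — the time-only slope clause and the THICK clause because NO slope exists at any point of the window — and no
slice has a germ of any of the three kinds. [folklore] -/
theorem twistingThick_false_without_mild :
    ¬ (∀ (C : ℝ) (v : ℝ → EuclideanSpace ℝ (Fin 3) → EuclideanSpace ℝ (Fin 3)),
      Literature.Analysis.FluidPDE.HasTypeITimeDecay C v →
      ContinuousOn (Function.uncurry v) (Set.Iio (0 : ℝ) ×ˢ Set.univ) →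
      (∀ t < 0, Literature.Analysis.FluidPDE.VectorCalculus.IsDivFree (v t)) →
      (∀ s < 0, ∀ y, ⟪Literature.Analysis.FluidPDE.curl (v s) y, EuclideanSpace.single 2 1⟫_ℝ = 0) →
      ∀ W : Set (ℝ × EuclideanSpace ℝ (Fin 3)), IsOpen W → W.Nonempty → W ⊆ Set.Iio (0 : ℝ) ×ˢ Set.univ →
        (∀ z ∈ W, Literature.Analysis.FluidPDE.curl (v z.1) z.2 ≠ 0 ∧
          (fderiv ℝ (v z.1) z.2 (EuclideanSpace.single 0 1) 2 ≠ 0 ∨ fderiv ℝ (v z.1) z.2 (EuclideanSpace.single 1 1) 2 ≠ 0) ∧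
          (fderiv ℝ (v z.1) z.2 (EuclideanSpace.single 2 1) 0 ≠ 0 ∨ fderiv ℝ (v z.1) z.2 (EuclideanSpace.single 2 1) 1 ≠ 0)) →
        (∀ m : ℝ → ℝ, ∀ W₁ : Set (ℝ × EuclideanSpace ℝ (Fin 3)), W₁ ⊆ W → IsOpen W₁ → W₁.Nonempty →
          ∃ z ∈ W₁, ∃ b : Fin 3, b ≠ 2 ∧
            fderiv ℝ (v z.1) z.2 (EuclideanSpace.single 2 1) b ≠
              m z.1 * fderiv ℝ (v z.1) z.2 (EuclideanSpace.single b 1) 2) →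
        (∀ z ∈ W,
          fderiv ℝ (fun x => fderiv ℝ (v z.1) x (EuclideanSpace.single 2 1) 2) z.2 (EuclideanSpace.single 0 1) *
              fderiv ℝ (v z.1) z.2 (EuclideanSpace.single 1 1) 2 -
            fderiv ℝ (fun x => fderiv ℝ (v z.1) x (EuclideanSpace.single 2 1) 2) z.2 (EuclideanSpace.single 1 1) *
              fderiv ℝ (v z.1) z.2 (EuclideanSpace.single 0 1) 2 ≠ 0) →
        (∀ m : ℝ → ℝ → ℝ, ∀ W₁ : Set (ℝ × EuclideanSpace ℝ (Fin 3)), W₁ ⊆ W → IsOpen W₁ → W₁.Nonempty →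
          ∃ z ∈ W₁, ∃ b : Fin 3, b ≠ 2 ∧
            fderiv ℝ (v z.1) z.2 (EuclideanSpace.single 2 1) b ≠
              m z.1 (z.2 2) * fderiv ℝ (v z.1) z.2 (EuclideanSpace.single b 1) 2) →
        ∃ s : ℝ, s < 0 ∧ ∃ U : Set (EuclideanSpace ℝ (Fin 3)), IsOpen U ∧ U.Nonempty ∧
          ((∃ e : EuclideanSpace ℝ (Fin 3), e ≠ 0 ∧
              ∀ y ∈ U, fderiv ℝ (Literature.Analysis.FluidPDE.curl (v s)) y e = 0) ∨
           (∃ c : EuclideanSpace ℝ (Fin 3), ∀ y ∈ U,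
              Literature.Analysis.FluidPDE.rotGen (Literature.Analysis.FluidPDE.curl (v s) y) =
                fderiv ℝ (Literature.Analysis.FluidPDE.curl (v s)) y (Literature.Analysis.FluidPDE.rotGen (y - c))) ∨
           (∃ w : EuclideanSpace ℝ (Fin 3) → EuclideanSpace ℝ (Fin 3), AnalyticOnNhd ℝ w Set.univ ∧
              ¬ BddAbove (Set.range fun y => ‖w y‖) ∧ ∀ y ∈ U, v s y = w y))) := by
  intro H
  obtain ⟨s, hs, U, hU, hne, halt⟩ := H 10 thickProfile hasTypeITimeDecay_thickProfile continuousOn_thickProfile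
    (fun t _ => isDivFree_thickProfile t) (fun s _ y => poloidal_thickProfile s y) thickWindow isOpen_thickWindow
    thickWindow_nonempty thickWindow_subset thickProfile_pins
    (fun m W₁ hW₁ _ hW₁n => thickProfile_slope_clause_time m W₁ hW₁ hW₁n) thickProfile_twist_ne_zero
    (fun m W₁ hW₁ _ hW₁n => thickProfile_slope_clause_timeHeight m W₁ hW₁ hW₁n)
  exact thickProfile_no_germ hs hU hne halt

/-- **… and FALSE with (M) replaced by real-analyticity (A) of every slice** (the witness is entire; it is NOT frozen, so
(F) cannot be added here — see `…Negative.frozen_defect_thickProfile`). [folklore] -/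
theorem twistingThick_false_without_mild_analytic :
    ¬ (∀ (C : ℝ) (v : ℝ → EuclideanSpace ℝ (Fin 3) → EuclideanSpace ℝ (Fin 3)),
      Literature.Analysis.FluidPDE.HasTypeITimeDecay C v →
      ContinuousOn (Function.uncurry v) (Set.Iio (0 : ℝ) ×ˢ Set.univ) →
      (∀ t < 0, Literature.Analysis.FluidPDE.VectorCalculus.IsDivFree (v t)) →
      (∀ s < 0, ∀ y, ⟪Literature.Analysis.FluidPDE.curl (v s) y, EuclideanSpace.single 2 1⟫_ℝ = 0) →
      (∀ s < 0, AnalyticOnNhd ℝ (v s) Set.univ) →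
      ∀ W : Set (ℝ × EuclideanSpace ℝ (Fin 3)), IsOpen W → W.Nonempty → W ⊆ Set.Iio (0 : ℝ) ×ˢ Set.univ →
        (∀ z ∈ W, Literature.Analysis.FluidPDE.curl (v z.1) z.2 ≠ 0 ∧
          (fderiv ℝ (v z.1) z.2 (EuclideanSpace.single 0 1) 2 ≠ 0 ∨ fderiv ℝ (v z.1) z.2 (EuclideanSpace.single 1 1) 2 ≠ 0) ∧
          (fderiv ℝ (v z.1) z.2 (EuclideanSpace.single 2 1) 0 ≠ 0 ∨ fderiv ℝ (v z.1) z.2 (EuclideanSpace.single 2 1) 1 ≠ 0)) →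
        (∀ m : ℝ → ℝ, ∀ W₁ : Set (ℝ × EuclideanSpace ℝ (Fin 3)), W₁ ⊆ W → IsOpen W₁ → W₁.Nonempty →
          ∃ z ∈ W₁, ∃ b : Fin 3, b ≠ 2 ∧
            fderiv ℝ (v z.1) z.2 (EuclideanSpace.single 2 1) b ≠
              m z.1 * fderiv ℝ (v z.1) z.2 (EuclideanSpace.single b 1) 2) →
        (∀ z ∈ W,
          fderiv ℝ (fun x => fderiv ℝ (v z.1) x (EuclideanSpace.single 2 1) 2) z.2 (EuclideanSpace.single 0 1) *
              fderiv ℝ (v z.1) z.2 (EuclideanSpace.single 1 1) 2 -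
            fderiv ℝ (fun x => fderiv ℝ (v z.1) x (EuclideanSpace.single 2 1) 2) z.2 (EuclideanSpace.single 1 1) *
              fderiv ℝ (v z.1) z.2 (EuclideanSpace.single 0 1) 2 ≠ 0) →
        (∀ m : ℝ → ℝ → ℝ, ∀ W₁ : Set (ℝ × EuclideanSpace ℝ (Fin 3)), W₁ ⊆ W → IsOpen W₁ → W₁.Nonempty →
          ∃ z ∈ W₁, ∃ b : Fin 3, b ≠ 2 ∧
            fderiv ℝ (v z.1) z.2 (EuclideanSpace.single 2 1) b ≠
              m z.1 (z.2 2) * fderiv ℝ (v z.1) z.2 (EuclideanSpace.single b 1) 2) →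
        ∃ s : ℝ, s < 0 ∧ ∃ U : Set (EuclideanSpace ℝ (Fin 3)), IsOpen U ∧ U.Nonempty ∧
          ((∃ e : EuclideanSpace ℝ (Fin 3), e ≠ 0 ∧
              ∀ y ∈ U, fderiv ℝ (Literature.Analysis.FluidPDE.curl (v s)) y e = 0) ∨
           (∃ c : EuclideanSpace ℝ (Fin 3), ∀ y ∈ U,
              Literature.Analysis.FluidPDE.rotGen (Literature.Analysis.FluidPDE.curl (v s) y) =
                fderiv ℝ (Literature.Analysis.FluidPDE.curl (v s)) y (Literature.Analysis.FluidPDE.rotGen (y - c))) ∨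
           (∃ w : EuclideanSpace ℝ (Fin 3) → EuclideanSpace ℝ (Fin 3), AnalyticOnNhd ℝ w Set.univ ∧
              ¬ BddAbove (Set.range fun y => ‖w y‖) ∧ ∀ y ∈ U, v s y = w y))) := by
  intro H
  obtain ⟨s, hs, U, hU, hne, halt⟩ := H 10 thickProfile hasTypeITimeDecay_thickProfile continuousOn_thickProfile
    (fun t _ => isDivFree_thickProfile t) (fun s _ y => poloidal_thickProfile s y)
    (fun s _ => analyticOnNhd_thickProfile s) thickWindow isOpen_thickWindow
    thickWindow_nonempty thickWindow_subset thickProfile_pins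
    (fun m W₁ hW₁ _ hW₁n => thickProfile_slope_clause_time m W₁ hW₁ hW₁n) thickProfile_twist_ne_zero
    (fun m W₁ hW₁ _ hW₁n => thickProfile_slope_clause_timeHeight m W₁ hW₁ hW₁n)
  exact thickProfile_no_germ hs hU hne halt

end Summit.NavierStokesRegularity.NavierStokesRegularity.Theorems.LrcModEntire.Negative

end
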